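import Summits.QuantumFields.BalabanUV.T4Continuum.Support.NE7StraightDefectLetters
import Summits.QuantumFields.BalabanUV.T4Continuum.Support.NE7CriticalPairingQbar
import Summits.QuantumFields.BalabanUV.T4Continuum.Support.NE7QcoarseCutoffStraight
import Summits.QuantumFields.BalabanUV.T4Continuum.Support.NE7QbarLipschitzBudget
import HarnessLib

/-!
# NE7StraightDefectAssembly — THE TWO-REGION CRITICALITY DEFECT OF THE TORUS ROAD v4 ON STRAIGHT TANGENTS, ASSEMBLED ((N2)-straight): for the global representative
# `W̃ = e^{A}` (skew periodic `A`, `‖A‖ ≤ α₀`, lattice differences `≤ α₁`, F51's budget on `Mα₀`) agreeing with a TANGENT-CRITICAL configuration `U′` of the multi-level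
# class near the support of a cutoff weight `χ′ ∈ [0,1]` (`χ′ = 1` off the far region `S`, constant on every level box not covered by `S`), every skew periodic STRAIGHT
# tangent `Y` (`(Qcoarse L)^[k+1] Y = 0`) has `|dAction_{W̃} Y| ≤ τn·‖Y‖_{1,near} + τf·‖Y‖_{1,far}` with `τn = c_R·C₅₁(Mα₀)·q^{k+1}` (the small factor `Mα₀`) and
# `τf = τn + c_R·q^{k+1} + ρ + 4#Plane·α₁` (`q = L∕L^d`, `c_R` = F53's first-variation letter of the right inverse)

Cell `pub-balaban`, rung (B)+1 sub-cell t4, lineage `b2b-balaban-t4-ne7-p1` (CRUX PROVER NE7 #1 = OWNER of row NE7), generation 89; memo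
`t4/b2b-balaban-t4-ne7-p1-g89/COSTING-N1.md` §7.  File F268 (over F264 `NE7CriticalPairingQbar.abs_dAction_le_cR_sum_norm_QbarIter_rightInvW`, F265∕F267 (`norm_QbarIter_weight_le_of_agree`,
`dAction_weight_congr`, `abs_dAction_vary_flat_le_dirL1`), F266 `NE7QcoarseCutoffStraight.sum_norm_iterate_Qcoarse_weight_le`, F51 `NE7QbarLipschitzBudget.sum_norm_QbarIter_vary_flat_sub_le`,
row NE3's `QbarIter_flat`, `NE7TangentTransportGauge.dAction_sub'`).

WHY (memo §7).  This is the supplier (N2) of the v4 END F263 `hape_of_torusRoadV4` in abstract form: its hypotheses are the chart's letters ((N1)-weak, through `U′ = U^u =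
e^{A}` near the plaquette and `A`'s sup∕gradient bounds), the class and tangent-criticality of `U′`, and the geometry of the cutoff; its conclusion is the END's defect
clause with `near = periodBox ∖ S`, `far = periodBox ∩ S`.
HOW.  `Y = χ′Y + (1−χ′)Y`.  Outer piece: F267 (a) on the far region (`χ′ = 1` off `S`).  Inner piece: `dAction_{W̃}(χ′Y) = dAction_{U′}(χ′Y)` (F267 (b)); `≤ c_R‖Q̄_{U′}(χ′Y)‖₁`
(F264); `≤ c_R‖Q̄_{W̃}(χ′Y)‖₁` (F267 (c)); `Q̄_{W̃} = (Q̄_{W̃} − Q̄_1) + Q^{k+1}`: F51 (`C₅₁·‖χ′Y‖₁ ≤ C₅₁(‖Y‖_{near} + ‖Y‖_{far})`) and F266 (`q^{k+1}‖Y‖_{far}`).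
WHAT ([folklore] composition; 0 def, 0 sorry; generic `d`, `L ≥ 2`).  **`abs_dAction_le_twoRegion_straight`** (statement spelled in full below).
HONEST FRAMING (page 1): composition BY NAME of tree theorems; the chart (N1)-weak is NOT supplied here (it is the agreement hypothesis); nothing of Bałaban's asserted;
NOT (APE), NOT ONE-STEP, NOT NE7; spine 0∕9; finite T⁴ rung (B)+1 — NOT infinite volume, NOT mass gap, NOT `BetaPertH`, NOT Clay.  Continuum YM on T⁴ ⇐ BetaPertH ∧
nine spine estimates (0/9 proved); BetaPertH ⇐ (D1) ∧ (D4) ∧ CAP+tail; G-an2-4 gates asym, D1 and NE2/3/4.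
-/

set_option autoImplicit false

open scoped BigOperators Matrix.Norms.L2Operator
open NormedSpace Finset Set

namespace Summit.QuantumFields.BalabanUV.T4Continuum.NE7StraightDefectAssembly

open Literature.MathematicalPhysics.QuantumFieldTheory.Balaban1983to89
open B7Prop1Explicit B7Prop2Explicit MatrixLog UnitaryModel
open T4AveragingDeficitWall (IsUnitaryCfg IsSkewDir SmallField vary dirL1)
open T4AveragingDeficitWallBoundary (IsPeriodicCfg periodBox)
open AveragingDeficitPeriodicCounting (IsPeriodicDir)
open AveragingDeficitMultiLevelPrep (LevelSmall)
open BlockAverageVaryHolo (nbRad)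
open BlockAverageVaryDisc (rho0)
open MinimalActionLevels (perWin)
open NE3HessForm (dAction)
open BlockAveragePushDirSplit (flat)
open NE3TangentFlatStructure (Qcoarse)
open NE3TangentCovariantTower (dirIter QbarIter QbarIter_flat)
open NE3LinearisedAverageSup (curvSum)
open NE3QbarIterCovLiftPrep (cruxC)
open NE3RightInverseSolveLetters (thetaLoc)
open NE3HatInvCurlLetters (curl1C curl1C_nonneg)
open NE7TangentTransportGauge (dAction_sub')
open NE7CriticalPairingQbar (abs_dAction_le_cR_sum_norm_QbarIter_rightInvW)
open NE7QcoarseCutoffStraight (sum_norm_iterate_Qcoarse_weight_le)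
open NE7QbarLipschitzBudget (sum_norm_QbarIter_vary_flat_sub_le)
open NE7StraightDefectLetters (abs_dAction_vary_flat_le_dirL1 dAction_weight_congr norm_QbarIter_weight_le_of_agree)

noncomputable section

variable {d : ℕ} {n : Type*} [Fintype n] [DecidableEq n]

/-- **THE TWO-REGION CRITICALITY DEFECT ON STRAIGHT TANGENTS** (statement in the module docstring; `M = L^{k+1}`, period `P = M·N`, `q = L∕L^d`).
Hypotheses: `U′` unitary `P`-periodic of the multi-level class (radius `x`, `LevelSmall`, `cruxC·M²x < 1`, `θ_loc·M²x < 1`, `M²x ≤ 1`, `SmallField U′ a`),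
TANGENT-CRITICAL; `A` skew `P`-periodic, `‖A‖ ≤ α₀`, lattice differences `≤ α₁`, F51's budgets on `Mα₀`; a periodic weight `0 ≤ χ′ ≤ 1` and a periodic site set `S` with:
every coarse bond's level slab sees a constant `χ′` or lies in `S`; `χ′ ≠ 1 ⇒ S`; `U′ = e^{A}` on the level slab of every coarse bond whose slab meets `{χ′ ≠ 0}`, and
on the four bonds of every plaquette with `χ′ ≠ 0` at one of its three base corners.  Conclusion: for every skew `P`-periodic `Y` with `(Qcoarse L)^[k+1] Y = 0`,
`|dAction (e^{A}) Y (perWin d P)| ≤ τn·‖Y‖_{ℓ¹(periodBox P ∖ S)} + τf·‖Y‖_{ℓ¹(periodBox P ∩ S)}`. [folklore] -/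
theorem abs_dAction_le_twoRegion_straight [Nonempty n] {L : ℕ} (hL : 2 ≤ L) (k : ℕ) {N : ℕ} [NeZero N]
    -- the tangent-critical gauge-fixed configuration `U′`
    {U' : Site d → Fin d → (Matrix n n ℂ)ˣ} {x a : ℝ}
    (hU'u : IsUnitaryCfg U') (hU'P : IsPeriodicCfg U' ((L ^ (k + 1) * N : ℕ) : ℤ)) (hx : 0 ≤ x) (hs : LevelSmall d L k x) (hU'x : SmallField U' x)
    (hθ : cruxC d L * (((L : ℝ) ^ (k + 1)) ^ 2 * x) < 1) (hθl : thetaLoc d L * (((L : ℝ) ^ (k + 1)) ^ 2 * x) < 1)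
    (hε : ((L : ℝ) ^ (k + 1)) ^ 2 * x ≤ 1) (ha : 0 ≤ a) (hU'a : SmallField U' a)
    (hcrit : ∀ Y' : Site d → Fin d → Matrix n n ℂ, IsSkewDir Y' → IsPeriodicDir Y' ((L ^ (k + 1) * N : ℕ) : ℤ) →
      dirIter L (k + 1) U' Y' = 0 → dAction U' Y' (perWin d (L ^ (k + 1) * N)) = 0)
    -- the global representative `e^{A}`
    {A : Site d → Fin d → Matrix n n ℂ} (hA : IsSkewDir A) (hAP : IsPeriodicDir A ((L ^ (k + 1) * N : ℕ) : ℤ))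
    {α₀ α₁ : ℝ} (hα₀ : 0 ≤ α₀) (hα₁ : 0 ≤ α₁) (hAα : ∀ (y : Site d) (μ : Fin d), ‖A y μ‖ ≤ α₀)
    (hA1 : ∀ (y : Site d) (κ τ : Fin d), ‖A (y + e τ) κ - A y κ‖ ≤ α₁)
    (hs0 : LevelSmall d L (k + 1) 0) (hcurv : curvSum d L (k + 1) 0 ≤ 2 / 3 * L)
    (hσ : 4 * (3 + 12 * (d : ℝ)) ^ 2 * (L : ℝ) ^ (k + 1) * α₀ ≤ rho0 d L ^ 2)
    (hS1 : (8 * (3 + 12 * (d : ℝ)) * (2 + 2 * (((d : ℝ) + 1) * L)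
        * (1 + ((1250 * ((nbRad d L : ℝ) + L) + 8 * (d * L) + 2 * L) * (d * (2 * nbRad d L + 1) ^ d)) / ((L : ℝ) / (L : ℝ) ^ d))))
        * ((L : ℝ) ^ (k + 1) * α₀) ≤ 1)
    (hb : 256 * ((d : ℝ) + 1) * L * (3 + 12 * (d : ℝ)) * ((L : ℝ) ^ (k + 1) * α₀) ≤ 1)
    -- the cutoff weight and the far region
    (g : Site d → ℝ) (hgP : ∀ (y : Site d) (i : Fin d), g (y + ((L ^ (k + 1) * N : ℕ) : ℤ) • e i) = g y) (hg01 : ∀ y : Site d, 0 ≤ g y ∧ g y ≤ 1)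
    (S : Site d → Prop) [DecidablePred S] (hSP : ∀ (y : Site d) (i : Fin d), S (y + ((L ^ (k + 1) * N : ℕ) : ℤ) • e i) ↔ S y)
    (hbox : ∀ (w : Site d) (τ : Fin d),
      (∃ g₀ : ℝ, ∀ y : Site d, (∀ i, (L : ℤ) ^ (k + 1) * w i ≤ y i ∧ y i ≤ (L : ℤ) ^ (k + 1) * w i + 2 * (L : ℤ) ^ (k + 1) - 1) → g y = g₀)
      ∨ (∀ y : Site d, (∀ i, (L : ℤ) ^ (k + 1) * w i ≤ y i ∧ y i ≤ (L : ℤ) ^ (k + 1) * w i + 2 * (L : ℤ) ^ (k + 1) - 1) → S y))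
    (hout : ∀ y : Site d, g y ≠ 1 → S y)
    (hagreeQ : ∀ (w : Site d) (τ : Fin d),
      (∃ y₀ : Site d, (∀ i, (L : ℤ) ^ (k + 1) * w i ≤ y₀ i ∧ y₀ i ≤ (L : ℤ) ^ (k + 1) * w i + 2 * (L : ℤ) ^ (k + 1) - 1) ∧ g y₀ ≠ 0) →
      ∀ (y : Site d) (μ : Fin d), (∀ i, (L : ℤ) ^ (k + 1) * w i ≤ y i ∧ y i ≤ (L : ℤ) ^ (k + 1) * w i + 2 * (L : ℤ) ^ (k + 1) - 1) →
        U' y μ = vary (flat (d := d) (n := n)) A 1 y μ)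
    (hagreeP : ∀ (z : Site d) (μ ν : Fin d), (g z ≠ 0 ∨ g (z + e μ) ≠ 0 ∨ g (z + e ν) ≠ 0) →
      vary (flat (d := d) (n := n)) A 1 z μ = U' z μ ∧ vary (flat (d := d) (n := n)) A 1 (z + e μ) ν = U' (z + e μ) ν ∧
      vary (flat (d := d) (n := n)) A 1 (z + e ν) μ = U' (z + e ν) μ ∧ vary (flat (d := d) (n := n)) A 1 z ν = U' z ν)
    -- the straight tangent
    {Y : Site d → Fin d → Matrix n n ℂ} (hY : IsSkewDir Y) (hYP : IsPeriodicDir Y ((L ^ (k + 1) * N : ℕ) : ℤ)) (hYQ : (Qcoarse L)^[k + 1] Y = 0) :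
    |dAction (vary (flat (d := d) (n := n)) A 1) Y (perWin d (L ^ (k + 1) * N))|
      ≤ (a * ((curl1C d L / (1 - thetaLoc d L * (((L : ℝ) ^ (k + 1)) ^ 2 * x))) * (((L : ℝ) ^ (k + 1)) ^ d / ((L : ℝ) ^ (k + 1)) ^ 2)))
          * (2 * ((8 * (3 + 12 * (d : ℝ)) * (2 + 2 * (((d : ℝ) + 1) * L)
              * (1 + ((1250 * ((nbRad d L : ℝ) + L) + 8 * (d * L) + 2 * L) * (d * (2 * nbRad d L + 1) ^ d)) / ((L : ℝ) / (L : ℝ) ^ d))))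
              * ((L : ℝ) ^ (k + 1) * α₀)) * ((L : ℝ) / (L : ℝ) ^ d) ^ (k + 1))
          * dirL1 Y ((periodBox (d := d) (L ^ (k + 1) * N)).filter (fun y => ¬ S y))
        + ((a * ((curl1C d L / (1 - thetaLoc d L * (((L : ℝ) ^ (k + 1)) ^ 2 * x))) * (((L : ℝ) ^ (k + 1)) ^ d / ((L : ℝ) ^ (k + 1)) ^ 2)))
            * (2 * ((8 * (3 + 12 * (d : ℝ)) * (2 + 2 * (((d : ℝ) + 1) * L)
              * (1 + ((1250 * ((nbRad d L : ℝ) + L) + 8 * (d * L) + 2 * L) * (d * (2 * nbRad d L + 1) ^ d)) / ((L : ℝ) / (L : ℝ) ^ d))))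
              * ((L : ℝ) ^ (k + 1) * α₀)) * ((L : ℝ) / (L : ℝ) ^ d) ^ (k + 1))
          + (a * ((curl1C d L / (1 - thetaLoc d L * (((L : ℝ) ^ (k + 1)) ^ 2 * x))) * (((L : ℝ) ^ (k + 1)) ^ d / ((L : ℝ) ^ (k + 1)) ^ 2)))
            * ((L : ℝ) / (L : ℝ) ^ d) ^ (k + 1)
          + ((Fintype.card (T4AveragingDeficitWall.Plane d) : ℝ)
              * (2 * (8 * α₀ * (2 * α₁ + 28 * α₀ ^ 2) + 6 * (Real.exp α₀ - 1) * (2 * α₁ + 24 * (Real.exp α₀ - 1) * α₀)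
                  + (2 * α₁ + 24 * (Real.exp α₀ - 1) * α₀) * (2 * α₁ + 28 * α₀ ^ 2) + 960 * (Real.exp α₀ - 1) * α₀ ^ 2)
                + 64 * α₀ * α₁)
            + 4 * (Fintype.card (T4AveragingDeficitWall.Plane d) : ℝ) * α₁))
          * dirL1 Y ((periodBox (d := d) (L ^ (k + 1) * N)).filter (fun y => S y)) := by
  classical
  have hL1 : 1 ≤ L := by omega
  have hN : 1 ≤ N := Nat.one_le_iff_ne_zero.mpr (NeZero.ne N)
  have hmc : N * L ^ (k + 1) = L ^ (k + 1) * N := Nat.mul_comm _ _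
  have hP1 : 1 ≤ L ^ (k + 1) * N := Nat.one_le_iff_ne_zero.mpr (Nat.mul_ne_zero (pow_ne_zero _ (by omega)) (NeZero.ne N))
  -- abbreviations for the constants (introduced as equations, rewritten syntactically)
  obtain ⟨cR, hcR⟩ : ∃ c : ℝ, c = a * ((curl1C d L / (1 - thetaLoc d L * (((L : ℝ) ^ (k + 1)) ^ 2 * x))) * (((L : ℝ) ^ (k + 1)) ^ d / ((L : ℝ) ^ (k + 1)) ^ 2)) :=
    ⟨_, rfl⟩
  obtain ⟨C51, hC51⟩ : ∃ c : ℝ, c = 2 * ((8 * (3 + 12 * (d : ℝ)) * (2 + 2 * (((d : ℝ) + 1) * L)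
      * (1 + ((1250 * ((nbRad d L : ℝ) + L) + 8 * (d * L) + 2 * L) * (d * (2 * nbRad d L + 1) ^ d)) / ((L : ℝ) / (L : ℝ) ^ d))))
      * ((L : ℝ) ^ (k + 1) * α₀)) * ((L : ℝ) / (L : ℝ) ^ d) ^ (k + 1) := ⟨_, rfl⟩
  obtain ⟨q, hq⟩ : ∃ c : ℝ, c = ((L : ℝ) / (L : ℝ) ^ d) ^ (k + 1) := ⟨_, rfl⟩
  obtain ⟨ρ', hρ'⟩ : ∃ c : ℝ, c = (Fintype.card (T4AveragingDeficitWall.Plane d) : ℝ)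
      * (2 * (8 * α₀ * (2 * α₁ + 28 * α₀ ^ 2) + 6 * (Real.exp α₀ - 1) * (2 * α₁ + 24 * (Real.exp α₀ - 1) * α₀)
          + (2 * α₁ + 24 * (Real.exp α₀ - 1) * α₀) * (2 * α₁ + 28 * α₀ ^ 2) + 960 * (Real.exp α₀ - 1) * α₀ ^ 2)
        + 64 * α₀ * α₁)
      + 4 * (Fintype.card (T4AveragingDeficitWall.Plane d) : ℝ) * α₁ := ⟨_, rfl⟩
  rw [← hC51, ← hcR, ← hq, ← hρ']
  have hcR0 : 0 ≤ cR := by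
    have hpos : 0 < 1 - thetaLoc d L * (((L : ℝ) ^ (k + 1)) ^ 2 * x) := by linarith
    have := curl1C_nonneg d L
    rw [hcR]; positivity
  have hC510 : 0 ≤ C51 := by rw [hC51]; positivity
  have hq0 : 0 ≤ q := by rw [hq]; positivity
  -- the regions
  set Bn : Finset (Site d) := (periodBox (d := d) (L ^ (k + 1) * N)).filter (fun y => ¬ S y) with hBn
  set Bf : Finset (Site d) := (periodBox (d := d) (L ^ (k + 1) * N)).filter (fun y => S y) with hBf
  have hnear0 : 0 ≤ dirL1 Y Bn := Finset.sum_nonneg fun _ _ => Finset.sum_nonneg fun _ _ => norm_nonneg _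
  have hfar0 : 0 ≤ dirL1 Y Bf := Finset.sum_nonneg fun _ _ => Finset.sum_nonneg fun _ _ => norm_nonneg _
  have hsplitY : dirL1 Y (periodBox (d := d) (L ^ (k + 1) * N)) = dirL1 Y Bf + dirL1 Y Bn := by
    unfold dirL1
    rw [hBf, hBn, Finset.sum_filter_add_sum_filter_not]
  -- the two pieces of `Y`
  set Wt : Site d → Fin d → (Matrix n n ℂ)ˣ := vary (flat (d := d) (n := n)) A 1 with hWt
  set Yin : Site d → Fin d → Matrix n n ℂ := fun y μ => g y • Y y μ with hYin
  have hYin_s : IsSkewDir Yin := fun y μ => skewAdjoint.smul_mem (g y) (hY y μ)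
  have hYin_P : IsPeriodicDir Yin ((L ^ (k + 1) * N : ℕ) : ℤ) := fun y i μ => by simp only [hYin, hgP y i, hYP y i μ]
  have hYout_s : IsSkewDir (fun y μ => Y y μ - Yin y μ) := fun y μ => (skewAdjoint (Matrix n n ℂ)).sub_mem (hY y μ) (hYin_s y μ)
  have hYout_P : IsPeriodicDir (fun y μ => Y y μ - Yin y μ) ((L ^ (k + 1) * N : ℕ) : ℤ) := fun y i μ => by
    simp only [hYP y i μ, hYin_P y i μ]
  have hdec : dAction Wt Y (perWin d (L ^ (k + 1) * N))
      = dAction Wt Yin (perWin d (L ^ (k + 1) * N)) + dAction Wt (fun y μ => Y y μ - Yin y μ) (perWin d (L ^ (k + 1) * N)) := by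
    rw [dAction_sub']; ring
  -- (a) the outer piece lives on the far region
  have hout_l1 : dirL1 (fun y μ => Y y μ - Yin y μ) (periodBox (d := d) (L ^ (k + 1) * N)) ≤ dirL1 Y Bf := by
    unfold dirL1
    rw [hBf, Finset.sum_filter]
    refine Finset.sum_le_sum fun y _ => ?_
    by_cases hy : S y
    · rw [if_pos hy]
      refine Finset.sum_le_sum fun μ _ => ?_
      have e1 : Y y μ - Yin y μ = (1 - g y) • Y y μ := by simp only [hYin, sub_smul, one_smul]
      show ‖Y y μ - Yin y μ‖ ≤ ‖Y y μ‖
      rw [e1, norm_smul, Real.norm_eq_abs]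
      have h01 := hg01 y
      have hg1 : |1 - g y| ≤ 1 := abs_le.mpr ⟨by linarith [h01.2], by linarith [h01.1]⟩
      exact mul_le_of_le_one_left (norm_nonneg _) hg1
    · rw [if_neg hy]
      have hg1 : g y = 1 := by by_contra hne; exact hy (hout y hne)
      refine le_of_eq (Finset.sum_eq_zero fun μ _ => ?_)
      show ‖Y y μ - Yin y μ‖ = 0
      simp only [hYin, hg1, one_smul, sub_self, norm_zero]
  have houter : |dAction Wt (fun y μ => Y y μ - Yin y μ) (perWin d (L ^ (k + 1) * N))| ≤ ρ' * dirL1 Y Bf := by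
    have h := abs_dAction_vary_flat_le_dirL1 hP1 hA hAP hα₀ hα₁ hAα hA1 hYout_s hYout_P
    rw [← hρ'] at h
    have hρ0 : 0 ≤ ρ' := by
      have hδe : 0 ≤ Real.exp α₀ - 1 := by linarith [Real.add_one_le_exp α₀]
      rw [hρ']; positivity
    exact h.trans (mul_le_mul_of_nonneg_left hout_l1 hρ0)
  -- (b) the inner piece is `U′`'s first variation
  have hinner_eq : dAction Wt Yin (perWin d (L ^ (k + 1) * N)) = dAction U' Yin (perWin d (L ^ (k + 1) * N)) :=
    dAction_weight_congr g Y _ hagreeP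
  -- (c) the critical pairing at `U′` (F264), period spelled `N·M`
  have hU'P' : IsPeriodicCfg U' ((N * L ^ (k + 1) : ℕ) : ℤ) := by rw [hmc]; exact hU'P
  have hcrit' : ∀ Y' : Site d → Fin d → Matrix n n ℂ, IsSkewDir Y' → IsPeriodicDir Y' ((N * L ^ (k + 1) : ℕ) : ℤ) →
      dirIter L (k + 1) U' Y' = 0 → dAction U' Y' (perWin d (N * L ^ (k + 1))) = 0 := by
    intro Y' h1 h2 h3; rw [hmc] at h2 ⊢; exact hcrit Y' h1 h2 h3
  have hYin_P' : IsPeriodicDir Yin ((N * L ^ (k + 1) : ℕ) : ℤ) := by rw [hmc]; exact hYin_P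
  have hpair := abs_dAction_le_cR_sum_norm_QbarIter_rightInvW hL k hU'u hU'P' hx hs hU'x hθ hθl hε ha hU'a hcrit' hYin_s hYin_P'
  rw [hmc, ← hcR] at hpair
  -- (d) back to the global background, bond by bond
  have hcomp : ∑ w ∈ periodBox N, ∑ τ : Fin d, ‖QbarIter L (k + 1) U' Yin w τ‖ ≤ ∑ w ∈ periodBox N, ∑ τ : Fin d, ‖QbarIter L (k + 1) Wt Yin w τ‖ :=
    Finset.sum_le_sum fun w _ => Finset.sum_le_sum fun τ _ => norm_QbarIter_weight_le_of_agree hL1 k hU'u hx hs hU'x g Y w τ (hagreeQ w τ)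
  -- (e) Lipschitz budget (F51) + shell term (F266)
  have hF51 := sum_norm_QbarIter_vary_flat_sub_le (n := n) (K := k + 1) (N := N) hL hs0 hcurv hA hAP hα₀ hAα hσ hS1 hb Yin hYin_P
  rw [← hC51] at hF51
  have hbox' : ∀ (w : Site d) (τ : Fin d),
      (∃ g₀ : ℝ, ∀ y : Site d, (∀ i, ((L ^ (k + 1) : ℕ) : ℤ) * w i ≤ y i ∧ y i ≤ ((L ^ (k + 1) : ℕ) : ℤ) * w i + 2 * ((L ^ (k + 1) : ℕ) : ℤ) - 1) → g y = g₀)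
      ∨ (∀ y : Site d, (∀ i, ((L ^ (k + 1) : ℕ) : ℤ) * w i ≤ y i ∧ y i ≤ ((L ^ (k + 1) : ℕ) : ℤ) * w i + 2 * ((L ^ (k + 1) : ℕ) : ℤ) - 1) → S y) := by
    intro w τ; simpa only [Nat.cast_pow] using hbox w τ
  have hF266 := sum_norm_iterate_Qcoarse_weight_le (n := n) hL1 k hN hYP hYQ g hgP (fun y => by rw [abs_le]; constructor <;> linarith [(hg01 y).1, (hg01 y).2])
    S hSP hbox'
  rw [← hq] at hF266
  have hflat : ∀ (w : Site d) (τ : Fin d), QbarIter L (k + 1) (flat (d := d) (n := n)) Yin w τ = (Qcoarse L)^[k + 1] Yin w τ := fun w τ => by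
    rw [QbarIter_flat hL1 (k + 1) Yin]
  have htri : ∑ w ∈ periodBox N, ∑ τ : Fin d, ‖QbarIter L (k + 1) Wt Yin w τ‖
      ≤ ∑ w ∈ periodBox N, ∑ τ : Fin d, ‖QbarIter L (k + 1) Wt Yin w τ - QbarIter L (k + 1) (flat (d := d) (n := n)) Yin w τ‖
        + ∑ w ∈ periodBox N, ∑ τ : Fin d, ‖(Qcoarse L)^[k + 1] Yin w τ‖ := by
    rw [← Finset.sum_add_distrib]
    refine Finset.sum_le_sum fun w _ => ?_
    rw [← Finset.sum_add_distrib]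
    refine Finset.sum_le_sum fun τ _ => ?_
    rw [← hflat]
    exact norm_le_norm_sub_add _ _
  have hYin_l1 : dirL1 Yin (periodBox (d := d) (L ^ (k + 1) * N)) ≤ dirL1 Y Bf + dirL1 Y Bn := by
    rw [← hsplitY]
    unfold dirL1
    refine Finset.sum_le_sum fun y _ => Finset.sum_le_sum fun μ _ => ?_
    show ‖g y • Y y μ‖ ≤ ‖Y y μ‖
    rw [norm_smul, Real.norm_eq_abs]
    have h01 := hg01 y
    have hg1 : |g y| ≤ 1 := abs_le.mpr ⟨by linarith [h01.1], h01.2⟩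
    exact mul_le_of_le_one_left (norm_nonneg _) hg1
  -- assemble
  have hinner : |dAction Wt Yin (perWin d (L ^ (k + 1) * N))| ≤ cR * (C51 * (dirL1 Y Bf + dirL1 Y Bn) + q * dirL1 Y Bf) := by
    rw [hinner_eq]
    refine hpair.trans (mul_le_mul_of_nonneg_left ?_ hcR0)
    refine hcomp.trans (htri.trans ?_)
    have h1 : ∑ w ∈ periodBox N, ∑ τ : Fin d, ‖QbarIter L (k + 1) Wt Yin w τ - QbarIter L (k + 1) (flat (d := d) (n := n)) Yin w τ‖
        ≤ C51 * (dirL1 Y Bf + dirL1 Y Bn) := hF51.trans (mul_le_mul_of_nonneg_left hYin_l1 hC510)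
    have h2 : ∑ w ∈ periodBox N, ∑ τ : Fin d, ‖(Qcoarse L)^[k + 1] Yin w τ‖ ≤ q * dirL1 Y Bf := hF266
    exact add_le_add h1 h2
  have habs : |dAction Wt Y (perWin d (L ^ (k + 1) * N))|
      ≤ |dAction Wt Yin (perWin d (L ^ (k + 1) * N))| + |dAction Wt (fun y μ => Y y μ - Yin y μ) (perWin d (L ^ (k + 1) * N))| := by
    rw [hdec]; exact abs_add_le _ _
  have hprod : 0 ≤ cR * C51 := mul_nonneg hcR0 hC510
  calc |dAction Wt Y (perWin d (L ^ (k + 1) * N))|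
      ≤ cR * (C51 * (dirL1 Y Bf + dirL1 Y Bn) + q * dirL1 Y Bf) + ρ' * dirL1 Y Bf := habs.trans (add_le_add hinner houter)
    _ = cR * C51 * dirL1 Y Bn + (cR * C51 + cR * q + ρ') * dirL1 Y Bf := by ring

end

end Summit.QuantumFields.BalabanUV.T4Continuum.NE7StraightDefectAssembly
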